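import Literature.MathematicalPhysics.QuantumFieldTheory.Balaban1983to89.B9CoReadingCoordsHolder

/-!
# `Balaban1983to89.B9CoReadingCoordsHolderAdm` — THE `Adm`-CUT HÖLDER PROBE FAMILY of the κ-fold coordinate model (the bond-sector PIN CARRIER with print's cut
# «|x − x′| ≦ 1» of (3.40) built into the pair weight), and the (3.43) co-reading `H1ReadsNbr` of def-Y's `kernelFamilyB` AT IT, for every letter and every configuration

T. Bałaban, *Propagators for lattice gauge theories in a background field*, Commun. Math. Phys. **99** (1985) 389–434
[`Balaban1985BackgroundPropagators`, "B9"]; [4] = T. Bałaban, *Propagators and renormalization transformations for lattice gauge theories. II*, Commun. Math.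
Phys. **96** (1984) 223–250 [`Balaban1984PropagatorsII`].

statement-level skeleton of published theorems with citation tags; proofs where landed; nothing here is a claim about the Yang–Mills mass gap

THE PRINT.  [B9] (3.40) p. 397: *"‖A‖_α = max_μ sup_{x,x′:|x−x′|≦1} |x′ − x|^{−α}|R(U(Γ_{x,x′}))A_μ(x′) − A_μ(x)|"* — the covariant Hölder quotient over the pairs AT DISTANCE
`≦ 1` on the `ξ = L^{−j}` lattice (def-Y's `B6KLevelCensusIndexV1.Adm`: same direction, `|x − x′|_∞ ≤ L^{j(y(x))} ∧ ≤ L^{j(y(x′))}`); (3.43) p. 398.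

WHY THIS FILE (cell `pub-ymgap`, Track A node N06 [B9]; seat `pub-ymgap-dag-n06-w6`, a SUPPLIER offer to the pin owner dag-n06-d).  n06-d's `B9CoReadingCoordsHolder`
indexes the pair probes of `holderProbesK` by ALL pairs `(x, x′)` with the weight `wK α x x′ = (|x − x′|_∞η)^{−α} > 0`, while def-Y's reader `holderQB` sums only over the
`Adm` pairs; consequently every probe-valued displayed majorant of the N06 certificate at the pin `𝔭A = holderProbesK …` (`Thm33G0DirX.pX0`, `Thm33G0Dir.h43L ∕ h43d`,
`Letters313H.pYDH ∕ pXDv`, rows 19's `HolderLegs310 ∕ FactorsHolder310`, `Letters313IML.pdgDvd`) also demands bounds at the FAR pair probes — a polynomial pair weight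
against the exponential kernel `e^{−δ₀d(y(x),y′)}`, inhabitable at a finite family only with volume-dependent constants (n06-w3's OBS-1 «PROBE-PAIRS-UNCUT»; this seat's
LOCATED-1).  node00-def-Y's ruling (WORD-OBS1-DOWN, 2026-08-28): *"WHERE THE CUT BELONGS = the PIN carrier (n06-d `holderProbesK`) … Bond sector: restricting `PK`'s pair
summands to `Adm` pairs re-proves `holderQB_le_of_probes` VERBATIM (holderQB never reads a non-Adm pair)"*.  THIS FILE executes that in its least-ripple form — a WEIGHT
cut, NO new index type: `wKA α x x′ := wK α x x′` on `Adm` pairs and `0` off them; `holderProbesKA := holderProbesK` with `wKA` in place of `wK` (same lattice `PK`, same anchors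
`blkPK bI`, point and transported-point probes unchanged) — so a certificate edition re-pins `h𝔭A` by the one-letter change `holderProbesK ↦ holderProbesKA`.
* §1 `wKA` (`wKA_of_adm`, `wKA_of_not_adm`, `wKA_nonneg`), ★ `holderProbesKA`, the probe values `ΦX_KA_inl_of_adm` (= the `wK` pair probe), `ΦX_KA_inl_of_not_adm` (= 0),
  `ΦX_KA_inr_inl`, `ΦX_KA_inr_inr` (= `holderProbesK`'s point probes), `ΦY_KA_eq_ΦX_KA`.
* §2 ★★ `holderQB_le_of_probesA` — n06-d's PRODUCT RULE `holderQB_le_of_probes` with the hypothesis on the CUT family only (the proof re-run: the pair probe is invoked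
  under `hadm` exactly where n06-d's already is).
* §3 ★★ `h1ReadsNbr_kernelFamilyB_coordsA`, §4 ★ `bond_h1ReadsNbr_of_pinsA` — the (3.43) co-reading `H1ReadsNbr (kernelFamilyB …) U₁ (holderProbesKA …) (RelB i) r …` and its
  form under the certificate's pin equations (radius 2): the twins of n06-d's §3–§4 at the cut carrier.
The H-Hölder and input co-readings at the cut carrier (twins of `B9CoReadingCoordsHHolder ∕ …Input`, both routed through §2) are the sequel `B9CoReadingCoordsHolderAdmReadings`.

HONEST SCOPE.  A sibling DEFINITION of the pin carrier plus verbatim re-proofs of n06-d's landed co-reading theorems at it; nothing of [B9] or [4] is asserted; no certificate edition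
is written here (the re-pin is the knit owner's decision); COUNT-NEUTRAL; N06 NOT discharged; one finite 𝕋^{d+1} programme at fixed ε — nothing continuum, nothing about the mass gap.
Cell `pub-ymgap` (HUMAN RULING D-0062), Track A node N06 [B9], seat `pub-ymgap-dag-n06-w6` (g0), 2026-08-28; a NEW file.
-/

noncomputable section

namespace Literature.MathematicalPhysics.QuantumFieldTheory.Balaban1983to89.B9CoReadingCoordsHolderAdm

open LatticeFieldCalculus (supDist)
open B9Eq39Adjoint (R R_sub R_smul R_zero)
open B6GlobalChartV1 (PV domT blkV1)
open B6Geom246MultiLevelTorus (geomT triangle_refl_nonneg_T)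
open B6Ineq2142KLevelV1 (β lvl)
open B6KLevelCensusIndexV1 (KIdx Adm adm_symm tpar tpar_nonneg kGeo)
open B9GeoNormsKLevelV1 (geo9K geo9K_supNorm_nonneg geo9K_cutH_nonneg)
open B9GeoLemma21KLevelV1 (one_le_Mh one_le_P)
open B9Thm34Ext (toB6)
open B9CoRealizesRelAtLetters (RelB)
open B9RWSumsReadsNbr (H1ReadsNbr)
open B9RWSums343Holder (HolderProbes)
open B9Thm39ReadingCoords (cR39 cR39_nonneg abs_repr_le)
open B9CoReadingCoords (assembleK assembleK_smul evDiagK assembleK_evDiagK coordOpK assembleK_coordOpK coordOpK_evDiagK cdBₗ cdsBₗ XBK evBK blkBK GcoK DcoK DscoK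
  DcoK_comp_GcoK GcoK_comp_DscoK off_bound_evBK)
open B9CoReadingCoordsHolder (PK blkPK probeK probeK_inl probeK_inr_inl probeK_inr_inr shiftR transR wnorm_le_of_coords wK w₀K wK_nonneg w₀K_nonneg wK_comm
  wK_eq_tpar_mul holderProbesK)
open Node00 (SiteY FBondY BlkY IBondY CfgY BallY liftY liftY_apply holderQB kernelFamilyB BondOpY BondParY cdB cdsB iSup_ball_le)

variable {d ℓ : ℕ} {hd : 1 ≤ d + 1} {hL : Odd (ℓ + 1) ∧ 1 < ℓ + 1} {b₀ b₁ : ℝ}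
variable {𝔸 : Type} [NormedRing 𝔸] [NormedAlgebra ℂ 𝔸]
variable {κ : Type} [Fintype κ] [DecidableEq κ]

/-! ## §1 The cut pair weight and the cut probe family -/

section Cut

variable [CompleteSpace 𝔸] (i : KIdx d ℓ hd hL b₀ b₁)

/-- ★ **THE `Adm`-CUT PAIR WEIGHT**: print's (3.40) weight `(|x − x′|η)^{−α}` on the admissible pairs (same direction, `|x − x′|_∞ ≤ L^{j(y(x))}`, `≤ L^{j(y(x′))}` — print's
«|x − x′| ≦ 1» on the ξ-lattice), and `0` on every other pair. [cite: Balaban1985BackgroundPropagators, (3.40) p.397 («sup_{x,x′:|x−x′|≦1}»)] -/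
def wKA (α : ℝ) (x x' : FBondY i) : ℝ := if Adm i x x' then wK i α x x' else 0

omit [CompleteSpace 𝔸] in
/-- on an admissible pair the cut weight is the printed weight. [cite: Balaban1985BackgroundPropagators, (3.40) p.397, bookkeeping] -/
theorem wKA_of_adm (α : ℝ) {x x' : FBondY i} (h : Adm i x x') : wKA i α x x' = wK i α x x' := if_pos h

omit [CompleteSpace 𝔸] in
/-- off the admissible pairs the cut weight vanishes. [cite: Balaban1985BackgroundPropagators, (3.40) p.397, bookkeeping] -/
theorem wKA_of_not_adm (α : ℝ) {x x' : FBondY i} (h : ¬ Adm i x x') : wKA i α x x' = 0 := if_neg h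

omit [CompleteSpace 𝔸] in
/-- `0 ≤ wKA`. [cite: Balaban1985BackgroundPropagators, (3.40) p.397, bookkeeping] -/
theorem wKA_nonneg (α : ℝ) (x x' : FBondY i) : 0 ≤ wKA i α x x' := by
  unfold wKA; split_ifs
  · exact wK_nonneg i α x x'
  · exact le_rfl

omit [CompleteSpace 𝔸] in
/-- the cut weight is symmetric in the pair. [cite: Balaban1985BackgroundPropagators, (3.40) p.397, bookkeeping] -/
theorem wKA_comm (α : ℝ) (x x' : FBondY i) : wKA i α x x' = wKA i α x' x := by
  unfold wKA
  by_cases h : Adm i x x'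
  · rw [if_pos h, if_pos (adm_symm i h), wK_comm]
  · have h' : ¬ Adm i x' x := fun h'' => h (adm_symm i h'')
    rw [if_neg h, if_neg h']

variable (b : Module.Basis κ ℝ 𝔸) (B : B9.Backgrounds) (cfg : B.Cfg → CfgY 𝔸 i) (par : BondParY 𝔸 i)

/-- ★ **THE `Adm`-CUT HÖLDER PROBES OF THE COORDINATE MODEL** (the pin carrier with print's cut): n06-d's `holderProbesK` with the pair weight `wKA` in place of `wK` — the
same probe lattice `PK`, the same anchors `blkPK bI`, the same point and transported-point probes; only the pair probes at non-admissible pairs are zero.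
[cite: Balaban1985BackgroundPropagators, (3.40) p.397 + (3.43) p.398; Balaban1984PropagatorsII, (2.51) p.232] -/
def holderProbesKA (bI : FBondY i → IBondY i) :
    HolderProbes (geo9K i) B (XBK κ i) (XBK κ i) (PK (FBondY i) (Fin (d + 1)) κ) (PK (FBondY i) (Fin (d + 1)) κ) where
  blkPX := blkPK bI
  blkPY := blkPK bI
  ΦX := fun U α => probeK b (fun x x' : FBondY i => par (cfg U) x.src x'.src) (wKA i α) (w₀K i α)
  ΦY := fun U α => probeK b (fun x x' : FBondY i => par (cfg U) x.src x'.src) (wKA i α) (w₀K i α)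

variable {bI : FBondY i → IBondY i}

omit [DecidableEq κ] in
/-- the anchors of the cut family are `holderProbesK`'s. [cite: Balaban1985BackgroundPropagators, (3.43) p.398, bookkeeping] -/
theorem blkPX_KA : (holderProbesKA i b B cfg par bI).blkPX = blkPK bI := rfl

omit [DecidableEq κ] in
/-- `ΦY = ΦX` for the cut family (as for `holderProbesK`). [cite: Balaban1985BackgroundPropagators, (3.43) p.398, bookkeeping] -/
theorem ΦY_KA_eq_ΦX_KA (U : B.Cfg) (α : ℝ) : (holderProbesKA i b B cfg par bI).ΦY U α = (holderProbesKA i b B cfg par bI).ΦX U α := rfl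

omit [DecidableEq κ] in
/-- ★ at an ADMISSIBLE pair the cut pair probe IS `holderProbesK`'s pair probe. [cite: Balaban1985BackgroundPropagators, (3.40) p.397, bookkeeping] -/
theorem ΦX_KA_inl_of_adm (U : B.Cfg) (α : ℝ) (F : XBK κ i → ℝ) {x x' : FBondY i} (h : Adm i x x') (ν : Fin (d + 1)) (c c' : κ) :
    (holderProbesKA i b B cfg par bI).ΦX U α F (Sum.inl ((x, x'), ν, c, c')) = (holderProbesK i b B cfg par bI).ΦX U α F (Sum.inl ((x, x'), ν, c, c')) := by
  show probeK b _ (wKA i α) (w₀K i α) F _ = probeK b _ (wK i α) (w₀K i α) F _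
  rw [probeK_inl, probeK_inl, wKA_of_adm i α h]

omit [DecidableEq κ] in
/-- ★ at a NON-admissible pair the cut pair probe VANISHES. [cite: Balaban1985BackgroundPropagators, (3.40) p.397 («|x−x′| ≦ 1»), bookkeeping] -/
theorem ΦX_KA_inl_of_not_adm (U : B.Cfg) (α : ℝ) (F : XBK κ i → ℝ) {x x' : FBondY i} (h : ¬ Adm i x x') (ν : Fin (d + 1)) (c c' : κ) :
    (holderProbesKA i b B cfg par bI).ΦX U α F (Sum.inl ((x, x'), ν, c, c')) = 0 := by
  show probeK b _ (wKA i α) (w₀K i α) F _ = 0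
  rw [probeK_inl, wKA_of_not_adm i α h, zero_mul]

omit [DecidableEq κ] in
/-- the transported point probes are `holderProbesK`'s. [cite: Balaban1985BackgroundPropagators, (3.40) p.397, bookkeeping] -/
theorem ΦX_KA_inr_inl (U : B.Cfg) (α : ℝ) (F : XBK κ i → ℝ) (p : (FBondY i × FBondY i) × Fin (d + 1) × κ × κ) :
    (holderProbesKA i b B cfg par bI).ΦX U α F (Sum.inr (Sum.inl p)) = (holderProbesK i b B cfg par bI).ΦX U α F (Sum.inr (Sum.inl p)) := by
  show probeK b _ (wKA i α) (w₀K i α) F _ = probeK b _ (wK i α) (w₀K i α) F _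
  rw [probeK_inr_inl, probeK_inr_inl]

omit [DecidableEq κ] in
/-- the point probes are `holderProbesK`'s. [cite: Balaban1985BackgroundPropagators, (3.39) p.397, bookkeeping] -/
theorem ΦX_KA_inr_inr (U : B.Cfg) (α : ℝ) (F : XBK κ i → ℝ) (p : FBondY i × Fin (d + 1) × κ × κ) :
    (holderProbesKA i b B cfg par bI).ΦX U α F (Sum.inr (Sum.inr p)) = (holderProbesK i b B cfg par bI).ΦX U α F (Sum.inr (Sum.inr p)) := by
  show probeK b _ (wKA i α) (w₀K i α) F _ = probeK b _ (wK i α) (w₀K i α) F _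
  rw [probeK_inr_inr, probeK_inr_inr]

end Cut

/-! ## §2 ★★ n06-d's product rule with the hypothesis on the cut family only -/

section Index

variable [CompleteSpace 𝔸] (i : KIdx d ℓ hd hL b₀ b₁) (b : Module.Basis κ ℝ 𝔸) [FiniteDimensional ℝ 𝔸]
variable {bI : FBondY i → IBondY i}

/-- ★★ **THE PRODUCT RULE FOR THE COVARIANT HÖLDER QUOTIENT, READ THROUGH THE CUT PROBES** — n06-d's `holderQB_le_of_probes` with the hypothesis on the CUT pair weight `wKA`:
`bI` 1-faithful, `2 ≤ r`, arbitrary unit transporters, `ζ` supported within block distance 1 of `β y`; if every cut pair probe and every (transported) point probe of the scaled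
coordinate model of the family `T` at the diagonal evaluation of `J`, anchored within `r` of `y`, is `≤ c`, then `holderQB (ζ · T ν (J ⊗ E)) ≤ c·(|ζ| + ‖ζ‖^ξ_α)` for `‖E‖ ≤ 1`.
The proof is n06-d's verbatim: `holderQB` sums over `Adm` pairs only, and there `wKA = wK`. [cite: Balaban1985BackgroundPropagators, (3.40) p.397 + (3.43) p.398; Balaban1984PropagatorsII, (2.51)–(2.52) p.232 + (2.54) p.233 + (2.137) p.247] -/
theorem holderQB_le_of_probesA
    (hβ1 : ∀ x : FBondY i, (geomT i.D).dist (β i.hN i.D i.hk (bI x)) (blkV1 i.hN i.D x) ≤ 1) {r : ℝ} (hr : 2 ≤ r)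
    (g : Site (PV d ℓ i.m i.K hd hL) 0 → Site (PV d ℓ i.m i.K hd hL) 0 → 𝔸ˣ)
    (T : Fin (d + 1) → (FBondY i → 𝔸) →ₗ[ℝ] (FBondY i → 𝔸)) (J : FBondY i → ℝ) (α : ℝ) (z : FBondY i → ℝ) (y : IBondY i) {c : ℝ} (hc : 0 ≤ c)
    (hcut : ∀ f, z f ≠ 0 → (geomT i.D).dist (blkV1 i.hN i.D f) (β i.hN i.D i.hk y) ≤ 1)
    (hP : ∀ p : PK (FBondY i) (Fin (d + 1)) κ, (geomT i.D).dist (β i.hN i.D i.hk (blkPK bI p)) (β i.hN i.D i.hk y) ≤ r →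
      |probeK b (fun x x' : FBondY i => g x.src x'.src) (wKA i α) (w₀K i α) ((cR39 b • coordOpK b T) (evDiagK J)) p| ≤ c)
    (E : BallY 𝔸) (ν : Fin (d + 1)) :
    holderQB i g α z (T ν (liftY J (E : 𝔸))) ≤ c * (kGeo i).cutH α z := by
  classical
  set F : XBK κ i → ℝ := (cR39 b • coordOpK b T) (evDiagK J) with hF
  set Ψ : FBondY i → 𝔸 := T ν (liftY J (E : 𝔸)) with hΨ
  have hE : ‖(E : 𝔸)‖ ≤ 1 := mem_closedBall_zero_iff.1 E.2
  -- the two sups of the cut-off class `|ζ| + ‖ζ‖^ξ_α`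
  set S₀ : ℝ := ⨆ f, |z f| with hS₀
  set Hz : ℝ := ⨆ q : FBondY i × FBondY i, (if Adm i q.1 q.2 then tpar i q.1 q.2 ^ (-α) * |z q.1 - z q.2| else 0) with hHz
  have hcutH : (kGeo i).cutH α z = S₀ + Hz := rfl
  have hS₀0 : 0 ≤ S₀ := Real.iSup_nonneg fun _ => abs_nonneg _
  have hzS : ∀ f, |z f| ≤ S₀ := fun f => le_ciSup (f := fun f => |z f|) (Finite.bddAbove_range _) f
  have hterm0 : ∀ q : FBondY i × FBondY i, 0 ≤ (if Adm i q.1 q.2 then tpar i q.1 q.2 ^ (-α) * |z q.1 - z q.2| else 0) := fun q => by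
    split_ifs
    · exact mul_nonneg (Real.rpow_nonneg (tpar_nonneg i _ _) _) (abs_nonneg _)
    · exact le_rfl
  have hHz0 : 0 ≤ Hz := Real.iSup_nonneg hterm0
  have hzH : ∀ x x' : FBondY i, Adm i x x' → tpar i x x' ^ (-α) * |z x - z x'| ≤ Hz := by
    intro x x' h
    have := le_ciSup (f := fun q : FBondY i × FBondY i => (if Adm i q.1 q.2 then tpar i q.1 q.2 ^ (-α) * |z q.1 - z q.2| else 0))
      (Finite.bddAbove_range _) (x, x')
    simpa only [if_pos h] using this
  have hcH0 : 0 ≤ c * (kGeo i).cutH α z := mul_nonneg hc (by rw [hcutH]; exact add_nonneg hS₀0 hHz0)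
  -- anchors: a bond where `ζ ≠ 0` has its index bond within distance 2 ≤ r of y
  have hnear : ∀ f, z f ≠ 0 → (geomT i.D).dist (β i.hN i.D i.hk (bI f)) (β i.hN i.D i.hk y) ≤ r := by
    intro f hf
    have htri := (triangle_refl_nonneg_T i.D (one_le_Mh i) (one_le_P i)).1 (β i.hN i.D i.hk (bI f)) (blkV1 i.hN i.D f) (β i.hN i.D i.hk y)
    linarith [hβ1 f, hcut f hf]
  -- the slices of the scaled coordinate vector
  have hFs : ∀ cc' : κ, assembleK b ν cc' F = cR39 b • T ν (liftY J (b cc')) := by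
    intro cc'; rw [hF, LinearMap.smul_apply, assembleK_smul, assembleK_coordOpK, assembleK_evDiagK]
  -- (a) the CUT pair probe at an anchored `x`, ADMISSIBLE partner `x′`: the weighted transported difference of `Ψ` is `≤ c`
  have hpair : ∀ x x' : FBondY i, z x ≠ 0 → Adm i x x' → wK i α x x' * ‖Ψ x - R (g x.src x'.src) (Ψ x')‖ ≤ c := by
    intro x x' hx hadm
    have h1 := fun cc cc' : κ => hP (Sum.inl ((x, x'), ν, cc, cc')) (hnear x hx)
    refine wnorm_le_of_coords b (shiftR (g x.src x'.src) x' ∘ₗ T ν) J x (wK_nonneg i α x x') hc (fun cc cc' => ?_) hE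
    have h2 := h1 cc cc'
    rw [probeK_inl, wKA_of_adm i α hadm] at h2
    simp only [hFs cc', Pi.smul_apply, R_smul, ← smul_sub, map_smul, Finsupp.smul_apply, smul_eq_mul] at h2
    exact h2
  -- (b) the point probe at an anchored `x`: the weighted point value of `Ψ` is `≤ c`
  have hpt : ∀ x : FBondY i, z x ≠ 0 → w₀K i α x * ‖Ψ x‖ ≤ c := by
    intro x hx
    have h1 := fun cc cc' : κ => hP (Sum.inr (Sum.inr (x, ν, cc, cc'))) (hnear x hx)
    refine wnorm_le_of_coords b (T ν) J x (w₀K_nonneg i α x) hc (fun cc cc' => ?_) hE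
    have h2 := h1 cc cc'
    rw [probeK_inr_inr] at h2
    simp only [hF, LinearMap.smul_apply, Pi.smul_apply, coordOpK_evDiagK, smul_eq_mul] at h2
    exact h2
  -- (c) the transported point probe of the pair `(x, x′)`, anchored at `x′`: the weighted transported value `R(U(Γ_{x,x′}))Ψ(x′)` is `≤ c`
  have hptR : ∀ x x' : FBondY i, z x' ≠ 0 → w₀K i α x' * ‖R (g x.src x'.src) (Ψ x')‖ ≤ c := by
    intro x x' hx'
    have h1 := fun cc cc' : κ => hP (Sum.inr (Sum.inl ((x, x'), ν, cc, cc'))) (hnear x' hx')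
    have key := wnorm_le_of_coords b (transR (g x.src x'.src) x' ∘ₗ T ν) J x (w₀K_nonneg i α x') hc (fun cc cc' => ?_) hE
    · exact key
    have h2 := h1 cc cc'
    rw [probeK_inr_inl] at h2
    simp only [hFs cc', Pi.smul_apply, R_smul, map_smul, Finsupp.smul_apply, smul_eq_mul] at h2
    exact h2
  -- scalar bookkeeping
  have hns : ∀ (r : ℝ) (X : 𝔸), ‖((r : ℝ) : ℂ) • X‖ = |r| * ‖X‖ := fun r X => by rw [norm_smul, Complex.norm_real, Real.norm_eq_abs]
  -- the sup over admissible pairs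
  unfold holderQB
  refine Real.iSup_le (fun q => ?_) hcH0
  obtain ⟨x, x'⟩ := q
  split_ifs with hadm
  swap
  · exact hcH0
  show wK i α x x' * ‖((z x : ℝ) : ℂ) • Ψ x - R (g x.src x'.src) (((z x' : ℝ) : ℂ) • Ψ x')‖ ≤ c * (kGeo i).cutH α z
  rw [hcutH, mul_add]
  by_cases hx : z x = 0 <;> by_cases hx' : z x' = 0
  · -- both vanish: the term is 0
    rw [hx, hx']; simp only [Complex.ofReal_zero, zero_smul, R_zero, sub_zero, norm_zero, mul_zero]
    exact add_nonneg (mul_nonneg hc hS₀0) (mul_nonneg hc hHz0)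
  · -- ζ(x) = 0 ≠ ζ(x′): one point probe at x′, weight through t(x′, x)
    rw [hx]; simp only [Complex.ofReal_zero, zero_smul, zero_sub, norm_neg, R_smul, hns]
    have hw : wK i α x x' = tpar i x' x ^ (-α) * w₀K i α x' := by rw [wK_comm, wK_eq_tpar_mul]
    calc wK i α x x' * (|z x'| * ‖R (g x.src x'.src) (Ψ x')‖)
        = (tpar i x' x ^ (-α) * |z x' - z x|) * (w₀K i α x' * ‖R (g x.src x'.src) (Ψ x')‖) := by rw [hw, hx, sub_zero]; ring
      _ ≤ Hz * c := mul_le_mul (hzH x' x (adm_symm i hadm)) (hptR x x' hx') (mul_nonneg (w₀K_nonneg i α x') (norm_nonneg _)) hHz0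
      _ ≤ c * S₀ + c * Hz := by nlinarith [mul_nonneg hc hS₀0]
  · -- ζ(x) ≠ 0 = ζ(x′): one point probe at x, weight through t(x, x′)
    rw [hx']; simp only [Complex.ofReal_zero, zero_smul, R_zero, sub_zero, hns]
    calc wK i α x x' * (|z x| * ‖Ψ x‖)
        = (tpar i x x' ^ (-α) * |z x - z x'|) * (w₀K i α x * ‖Ψ x‖) := by rw [wK_eq_tpar_mul, hx', sub_zero]; ring
      _ ≤ Hz * c := mul_le_mul (hzH x x' hadm) (hpt x hx) (mul_nonneg (w₀K_nonneg i α x) (norm_nonneg _)) hHz0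
      _ ≤ c * S₀ + c * Hz := by nlinarith [mul_nonneg hc hS₀0]
  · -- both non-zero: the product rule (the pair probe is used HERE, under `hadm`)
    have hsplit : ((z x : ℝ) : ℂ) • Ψ x - R (g x.src x'.src) (((z x' : ℝ) : ℂ) • Ψ x') =
        ((z x : ℝ) : ℂ) • (Ψ x - R (g x.src x'.src) (Ψ x')) + (((z x - z x' : ℝ) : ℂ)) • R (g x.src x'.src) (Ψ x') := by
      rw [R_smul, smul_sub, Complex.ofReal_sub, sub_smul]; abel
    rw [hsplit]
    have hw : wK i α x x' = tpar i x' x ^ (-α) * w₀K i α x' := by rw [wK_comm, wK_eq_tpar_mul]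
    calc wK i α x x' * ‖((z x : ℝ) : ℂ) • (Ψ x - R (g x.src x'.src) (Ψ x')) + ((z x - z x' : ℝ) : ℂ) • R (g x.src x'.src) (Ψ x')‖
        ≤ wK i α x x' * (|z x| * ‖Ψ x - R (g x.src x'.src) (Ψ x')‖ + |z x - z x'| * ‖R (g x.src x'.src) (Ψ x')‖) := by
          refine mul_le_mul_of_nonneg_left ((norm_add_le _ _).trans ?_) (wK_nonneg i α x x')
          rw [hns, hns]
      _ = |z x| * (wK i α x x' * ‖Ψ x - R (g x.src x'.src) (Ψ x')‖) +
            (tpar i x' x ^ (-α) * |z x' - z x|) * (w₀K i α x' * ‖R (g x.src x'.src) (Ψ x')‖) := by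
          rw [abs_sub_comm (z x) (z x'), hw]; ring
      _ ≤ S₀ * c + Hz * c := add_le_add (mul_le_mul (hzS x) (hpair x x' hx hadm) (mul_nonneg (wK_nonneg i α x x') (norm_nonneg _)) hS₀0)
          (mul_le_mul (hzH x' x (adm_symm i hadm)) (hptR x x' hx') (mul_nonneg (w₀K_nonneg i α x') (norm_nonneg _)) hHz0)
      _ = c * S₀ + c * Hz := by ring

end Index

/-! ## §3 ★★ The (3.43) co-reading `H1ReadsNbr` of `kernelFamilyB` at the cut carrier -/

section H1

variable [CompleteSpace 𝔸] [FiniteDimensional ℝ 𝔸] (i : KIdx d ℓ hd hL b₀ b₁) (b : Module.Basis κ ℝ 𝔸)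
variable (B : B9.Backgrounds) (cfg : B.Cfg → CfgY 𝔸 i) (O : BondOpY 𝔸 i) (par : BondParY 𝔸 i) (U₁ : B.Cfg)
variable {bI : FBondY i → IBondY i}

/-- ★★ **`H1ReadsNbr (kernelFamilyB i B cfg O par) U₁ (holderProbesKA …) (RelB i) r (blkBK bI) (blkBK bI) evBK evBK (DcoK ∘ₗ GcoK) (GcoK ∘ₗ DscoK)`** for EVERY bond-sector
letter `O`, EVERY `U₁`, every real basis `b`, every radius `r ≥ 2`, given `bI` carrier-faithful (`hβI`) and 1-faithful (`hβ1`) — n06-d's `h1ReadsNbr_kernelFamilyB_coords` AT THE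
CUT CARRIER (`holderQB_le_of_probesA` twice). [cite: Balaban1985BackgroundPropagators, (3.43) p.398 + (3.40) p.397; Balaban1984PropagatorsII, (2.51)–(2.52) p.232 + (2.54) p.233] -/
theorem h1ReadsNbr_kernelFamilyB_coordsA [Fintype (geo9K i).Site]
    (hβI : ∀ (x : FBondY i) (c : IBondY i), blkV1 i.hN i.D x = β i.hN i.D i.hk c → β i.hN i.D i.hk (bI x) = blkV1 i.hN i.D x)
    (hβ1 : ∀ x : FBondY i, (geomT i.D).dist (β i.hN i.D i.hk (bI x)) (blkV1 i.hN i.D x) ≤ 1) {r : ℝ} (hr : 2 ≤ r) :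
    H1ReadsNbr (kernelFamilyB i B cfg O par) U₁ (holderProbesKA i b B cfg par bI) (RelB i) r (blkBK i bI) (blkBK i bI) (evBK i) (evBK i)
      (DcoK i b B cfg U₁ ∘ₗ GcoK i b B cfg O U₁) (GcoK i b B cfg O U₁ ∘ₗ DscoK i b B cfg U₁) := by
  obtain ⟨hoff, hbd⟩ := off_bound_evBK (κ := κ) i hβI
  refine ⟨hoff, hbd, hoff, hbd, fun lam => geo9K_supNorm_nonneg i lam, fun α ζ => geo9K_cutH_nonneg i α ζ, ?_⟩
  intro lam α ζ y c hc hcut hPY hPX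
  have h0 : 0 ≤ c * (geo9K i).cutH α ζ := mul_nonneg hc (geo9K_cutH_nonneg i α ζ)
  cases lam with
  | inl f => cases ζ with
    | inl zz => exact h0
    | inr zz => exact h0
  | inr J => cases ζ with
    | inl zz => exact h0
    | inr zz =>
        show (⨆ E : BallY 𝔸, max (⨆ ν : Fin (d + 1), holderQB i (par (cfg U₁)) α zz (cdB i (cfg U₁) ν (O (cfg U₁) (liftY J (E : 𝔸)))))
            (⨆ ν : Fin (d + 1), holderQB i (par (cfg U₁)) α zz (O (cfg U₁) (cdsB i (cfg U₁) ν (liftY J (E : 𝔸)))))) ≤ c * (kGeo i).cutH α zz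
        have hev : evBK (κ := κ) i (Sum.inr J) = evDiagK J := rfl
        rw [DcoK_comp_GcoK, hev] at hPY
        rw [GcoK_comp_DscoK, hev] at hPX
        refine iSup_ball_le (fun E => max_le (Real.iSup_le (fun ν => ?_) h0) (Real.iSup_le (fun ν => ?_) h0)) h0
        · exact holderQB_le_of_probesA i b hβ1 hr (par (cfg U₁)) (fun ν => B9CoReadingCoords.cdBₗ i (cfg U₁) ν ∘ₗ (O (cfg U₁)).restrictScalars ℝ) J α zz y hc
            hcut hPY E ν
        · exact holderQB_le_of_probesA i b hβ1 hr (par (cfg U₁)) (fun ν => (O (cfg U₁)).restrictScalars ℝ ∘ₗ B9CoReadingCoords.cdsBₗ i (cfg U₁) ν) J α zz y hc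
            hcut hPX E ν

end H1

/-! ## §4 ★ Under the certificate's pin equations (radius 2) -/

section Pins

variable [CompleteSpace 𝔸] [FiniteDimensional ℝ 𝔸] (i : KIdx d ℓ hd hL b₀ b₁) (b : Module.Basis κ ℝ 𝔸)
variable (B : B9.Backgrounds) (cfg : B.Cfg → CfgY 𝔸 i) (O : BondOpY 𝔸 i) (par : BondParY 𝔸 i) (U₁ : B.Cfg)
variable {bI : FBondY i → IBondY i}

/-- ★ **THE (3.43) CO-READING AT THE CUT CARRIER UNDER THE PINS, RADIUS 2**: for walk-letter block maps `blk = blkY = blkBK bI` and operators `G = GcoK …`, `D = DcoK …`,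
`Ds = DscoK …` (the certificate's pin equations), `H1ReadsNbr (kernelFamilyB …) U₁ (holderProbesKA …) (RelB i) 2 blk blkY evBK evBK (D ∘ₗ G) (G ∘ₗ Ds)` HOLDS — the twin of n06-d's
`bond_h1ReadsNbr_of_pins` that a re-pinned edition (`h𝔭A : 𝔭A x = holderProbesKA …`) consumes verbatim. [cite: Balaban1985BackgroundPropagators, (3.43) p.398 + (3.40) p.397; Balaban1984PropagatorsII, (2.51)–(2.52) p.232 + (2.54) p.233] -/
theorem bond_h1ReadsNbr_of_pinsA [Fintype (geo9K i).Site]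
    (hβI : ∀ (x : FBondY i) (c : IBondY i), blkV1 i.hN i.D x = β i.hN i.D i.hk c → β i.hN i.D i.hk (bI x) = blkV1 i.hN i.D x)
    (hβ1 : ∀ x : FBondY i, (geomT i.D).dist (β i.hN i.D i.hk (bI x)) (blkV1 i.hN i.D x) ≤ 1)
    {blk blkY : XBK κ i → IBondY i} {G D Ds : (XBK κ i → ℝ) →ₗ[ℝ] (XBK κ i → ℝ)} (hblk : blk = blkBK i bI) (hblkY : blkY = blkBK i bI)
    (hG : G = GcoK i b B cfg O U₁) (hD : D = DcoK i b B cfg U₁) (hDs : Ds = DscoK i b B cfg U₁) :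
    H1ReadsNbr (kernelFamilyB i B cfg O par) U₁ (holderProbesKA i b B cfg par bI) (RelB i) 2 blk blkY (evBK i) (evBK i) (D ∘ₗ G) (G ∘ₗ Ds) := by
  subst hblk hblkY hG hD hDs
  exact h1ReadsNbr_kernelFamilyB_coordsA i b B cfg O par U₁ hβI hβ1 le_rfl

end Pins

end Literature.MathematicalPhysics.QuantumFieldTheory.Balaban1983to89.B9CoReadingCoordsHolderAdm

end
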